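import Summits.ValiantsHypothesis.ValiantsHypothesis.Theorems.KPlusLogSqLawWeakLiftingTowerGraftTwoSidedThreeLetters

/-!
# The two-sided three-letter `2m` law is SHARP for every `m` (pub-symmetroid LINE (B) `tower_graft`, helper lane)

Companion to `…TwoSidedThreeLettersLaw` (`TwoSidedThree.card_posRoots_le_two_mul`: a symmetric pencil
`X^{d₀}A + X^{d₀+e}J + X^{d₀+3e}B` with `A ≻ 0`, `B ≻ 0` and definite-type positive roots has at most `2m` positive determinant
zeros).  Here we record, sorry-free and def-free, that the number `2m` is ATTAINED inside the class for EVERY `m`, by the explicit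
DIAGONAL pencil on the support `(0,1,3)`

  `A = diag(6·27^i) ≻ 0`,  `J = diag(−7·9^i)`,  `B = 1 ≻ 0`,  `i < m`,

whose determinant `∏ᵢ (X − 3^i)(X − 2·3^i)(X + 3·3^i)` has EXACTLY the `2m` distinct positive zeros `{3^i, 2·3^i : i < m}`
(`card_posRoots_diag_eq_two_mul`, and `card_posRoots_diag_census_eq_two_mul` in the census currency
`∑ₖ X^{dₖ} • Sₖ.map C`, `d = ![0,1,3]`, `S = ![A,J,B]`).  So the word count `ζ(m; A ≻ 0, J, B ≻ 0 on (d₀,d₀+e,d₀+3e))` is `2m` on the nose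
for generic pencils: linear in `m`, against the Descartes cap `2m + ⌊…⌋` of the sign pattern (`8` versus `6` at `m = 3`).

Honest scope: an explicit example; nothing here bears on S4/S4b/S4d/S4f/S5, (TB), 19561 proper, 18050 or VP ≠ VNP.
-/

set_option linter.dupNamespace false
set_option autoImplicit false

namespace Summit.ValiantsHypothesis.ValiantsHypothesis.Theorems.KPlusLogSqLaw.TowerGraft

open Matrix
open scoped BigOperators

namespace TwoSidedThree

section Sharp

open Polynomial

variable (m : ℕ)

/-- The scales `λᵢ = 3^i` are positive. -/
theorem lam_pos (i : Fin m) : (0 : ℝ) < (3 : ℝ) ^ (i : ℕ) := by positivity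

/-- The cubic `X³ − 7λ²X + 6λ³ = (X − λ)(X − 2λ)(X + 3λ)` (no `X²` term: it lives on the support `(0,1,3)`). [folklore] -/
theorem cubic_factor (lam : ℝ) :
    (C (6 * lam ^ 3) + C (-7 * lam ^ 2) * X + X ^ 3 : ℝ[X]) = (X - C lam) * (X - C (2 * lam)) * (X + C (3 * lam)) := by
  have : (X + C (3 * lam) : ℝ[X]) = X - C (-(3 * lam)) := by rw [map_neg, sub_neg_eq_add]
  rw [this]
  apply Polynomial.funext
  intro x
  simp only [eval_add, eval_mul, eval_sub, eval_X, eval_C, eval_pow]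
  ring

/-- The lower letter `A = diag(6·27^i)` is positive definite. -/
theorem diagA_posDef : (Matrix.diagonal fun i : Fin m => (6 * ((3 : ℝ) ^ (i : ℕ)) ^ 3)).PosDef :=
  Matrix.posDef_diagonal_iff.mpr fun i => by positivity

/-- The upper letter `B = 1` is positive definite. -/
theorem one_posDef' : (1 : Matrix (Fin m) (Fin m) ℝ).PosDef := Matrix.PosDef.one

/-- The pivot `J = diag(−7·9^i)` is symmetric (and negative definite). -/
theorem diagJ_isSymm : (Matrix.diagonal fun i : Fin m => (-7 * ((3 : ℝ) ^ (i : ℕ)) ^ 2)).IsSymm :=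
  Matrix.diagonal_transpose _

/-- The diagonal pencil is `diagonal (cubics)`. -/
theorem diag_pencil_eq :
    (Matrix.diagonal fun i : Fin m => (6 * ((3 : ℝ) ^ (i : ℕ)) ^ 3)).map C
        + (X : ℝ[X]) • (Matrix.diagonal fun i : Fin m => (-7 * ((3 : ℝ) ^ (i : ℕ)) ^ 2)).map C
        + (X : ℝ[X]) ^ 3 • (1 : Matrix (Fin m) (Fin m) ℝ).map C
      = Matrix.diagonal fun i : Fin m => (C (6 * ((3 : ℝ) ^ (i : ℕ)) ^ 3) + C (-7 * ((3 : ℝ) ^ (i : ℕ)) ^ 2) * X + X ^ 3 : ℝ[X]) := by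
  ext i j : 1
  by_cases hij : i = j
  · subst hij
    simp only [Matrix.add_apply, Matrix.smul_apply, Matrix.map_apply, Matrix.diagonal_apply_eq, Matrix.one_apply_eq,
      map_one, smul_eq_mul, mul_one]
    ring
  · simp only [Matrix.add_apply, Matrix.smul_apply, Matrix.map_apply, Matrix.diagonal_apply_ne _ hij, Matrix.one_apply_ne hij,
      map_zero, smul_zero, add_zero]

/-- **SHARPNESS OF THE `2m` LAW.**  For every `m` the DIAGONAL pencil `A + X J + X³ B` with `A = diag(6·27^i) ≻ 0`,
`J = diag(−7·9^i)`, `B = 1 ≻ 0` (support `(0,1,3)`: the two-sided word with a negative definite pivot) has EXACTLY `2m` distinct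
positive determinant zeros, namely `{3^i, 2·3^i : i < m}` (all simple; the remaining `m` zeros `−3^{i+1}` are negative): the bound
`2m` of `card_posRoots_le_two_mul` / `card_posRoots_le_two_mul_of_definite` is attained for every `m`. [folklore] -/
theorem card_posRoots_diag_eq_two_mul :
    ((Matrix.det ((Matrix.diagonal fun i : Fin m => (6 * ((3 : ℝ) ^ (i : ℕ)) ^ 3)).map C
        + (X : ℝ[X]) • (Matrix.diagonal fun i : Fin m => (-7 * ((3 : ℝ) ^ (i : ℕ)) ^ 2)).map C
        + (X : ℝ[X]) ^ 3 • (1 : Matrix (Fin m) (Fin m) ℝ).map C)).roots.toFinset.filter (fun t => 0 < t)).card = 2 * m := by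
  classical
  set f : Fin m → ℝ[X] := fun i => C (6 * ((3 : ℝ) ^ (i : ℕ)) ^ 3) + C (-7 * ((3 : ℝ) ^ (i : ℕ)) ^ 2) * X + X ^ 3 with hf
  rw [diag_pencil_eq, Matrix.det_diagonal]
  -- the product is non-zero and vanishes exactly at `3^i`, `2·3^i`, `−3·3^i`
  have hfac : ∀ i : Fin m, f i = (X - C ((3 : ℝ) ^ (i : ℕ))) * (X - C (2 * (3 : ℝ) ^ (i : ℕ))) * (X + C (3 * (3 : ℝ) ^ (i : ℕ))) :=
    fun i => cubic_factor _
  have hfne : ∀ i : Fin m, f i ≠ 0 := by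
    intro i
    rw [hfac]
    refine mul_ne_zero (mul_ne_zero (X_sub_C_ne_zero _) (X_sub_C_ne_zero _)) ?_
    rw [show (X + C (3 * (3 : ℝ) ^ (i : ℕ)) : ℝ[X]) = X - C (-(3 * (3 : ℝ) ^ (i : ℕ))) by rw [map_neg, sub_neg_eq_add]]
    exact X_sub_C_ne_zero _
  have hprod : (∏ i, f i) ≠ 0 := Finset.prod_ne_zero_iff.mpr fun i _ => hfne i
  have hroot1 : ∀ i : Fin m, ((3 : ℝ) ^ (i : ℕ)) ∈ (∏ i, f i).roots.toFinset.filter (fun t => 0 < t) := by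
    intro i
    rw [Finset.mem_filter, Multiset.mem_toFinset, mem_roots hprod]
    refine ⟨?_, lam_pos m i⟩
    rw [IsRoot, eval_prod]
    exact Finset.prod_eq_zero (Finset.mem_univ i) (by rw [hfac]; simp)
  have hroot2 : ∀ i : Fin m, (2 * (3 : ℝ) ^ (i : ℕ)) ∈ (∏ i, f i).roots.toFinset.filter (fun t => 0 < t) := by
    intro i
    rw [Finset.mem_filter, Multiset.mem_toFinset, mem_roots hprod]
    refine ⟨?_, by have := lam_pos m i; linarith⟩
    rw [IsRoot, eval_prod]
    exact Finset.prod_eq_zero (Finset.mem_univ i) (by rw [hfac]; simp)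
  -- the `2m` roots are distinct: a power of three is never twice a power of three (odd ≠ even)
  have hne : ∀ i j : Fin m, ((3 : ℝ) ^ (i : ℕ)) ≠ 2 * (3 : ℝ) ^ (j : ℕ) := by
    intro i j h
    have h' : (3 : ℕ) ^ (i : ℕ) = 2 * 3 ^ (j : ℕ) := by exact_mod_cast h
    have hodd : Odd ((3 : ℕ) ^ (i : ℕ)) := Odd.pow (by decide)
    exact (Nat.not_even_iff_odd.mpr hodd) (even_iff_two_dvd.mpr ⟨_, h'⟩)
  -- the root set is the image of `Fin m ⊕ Fin m`
  let g : Fin m ⊕ Fin m → ℝ := Sum.elim (fun i : Fin m => (3 : ℝ) ^ (i : ℕ)) (fun i : Fin m => 2 * (3 : ℝ) ^ (i : ℕ))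
  have hg : Function.Injective g := by
    intro x y h
    rcases x with i | i <;> rcases y with j | j <;> simp only [g, Sum.elim_inl, Sum.elim_inr] at h
    · have h' : (3 : ℕ) ^ (i : ℕ) = 3 ^ (j : ℕ) := by exact_mod_cast h
      exact congrArg Sum.inl (Fin.ext (Nat.pow_right_injective (by norm_num) h'))
    · exact absurd h (hne i j)
    · exact absurd h.symm (hne j i)
    · have h' : (3 : ℕ) ^ (i : ℕ) = 3 ^ (j : ℕ) := by exact_mod_cast (by linarith : (3 : ℝ) ^ (i : ℕ) = (3 : ℝ) ^ (j : ℕ))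
      exact congrArg Sum.inr (Fin.ext (Nat.pow_right_injective (by norm_num) h'))
  have hsub : (Finset.univ.image g) ⊆ (∏ i, f i).roots.toFinset.filter (fun t => 0 < t) := by
    intro x hx
    obtain ⟨y, -, rfl⟩ := Finset.mem_image.mp hx
    rcases y with i | i
    · simp only [g, Sum.elim_inl]; exact hroot1 i
    · simp only [g, Sum.elim_inr]; exact hroot2 i
  have hsup : (∏ i, f i).roots.toFinset.filter (fun t => 0 < t) ⊆ Finset.univ.image g := by
    intro x hx
    rw [Finset.mem_filter, Multiset.mem_toFinset, mem_roots hprod, IsRoot, eval_prod, Finset.prod_eq_zero_iff] at hx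
    obtain ⟨⟨i, -, hi⟩, hxpos⟩ := hx
    rw [hfac] at hi
    simp only [eval_mul, eval_sub, eval_add, eval_X, eval_C, mul_eq_zero] at hi
    rcases hi with (hi | hi) | hi
    · exact Finset.mem_image.mpr ⟨Sum.inl i, Finset.mem_univ _, by simp only [g, Sum.elim_inl]; linarith⟩
    · exact Finset.mem_image.mpr ⟨Sum.inr i, Finset.mem_univ _, by simp only [g, Sum.elim_inr]; linarith⟩
    · exfalso; have := lam_pos m i; linarith
  rw [Finset.Subset.antisymm hsup hsub, Finset.card_image_of_injective _ hg]
  simp [two_mul]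

/-- Consequently at least `2m` positive zeros (the form used against upper-bound laws). -/
theorem two_mul_le_card_posRoots_diag :
    2 * m ≤ ((Matrix.det ((Matrix.diagonal fun i : Fin m => (6 * ((3 : ℝ) ^ (i : ℕ)) ^ 3)).map C
        + (X : ℝ[X]) • (Matrix.diagonal fun i : Fin m => (-7 * ((3 : ℝ) ^ (i : ℕ)) ^ 2)).map C
        + (X : ℝ[X]) ^ 3 • (1 : Matrix (Fin m) (Fin m) ℝ).map C)).roots.toFinset.filter (fun t => 0 < t)).card :=
  (card_posRoots_diag_eq_two_mul m).ge

/-- **Census currency.**  The same count for the pencil written as `∑ₖ X^{dₖ} • Sₖ.map C` with `d = ![0,1,3]` (`= ![d₀, d₀+e, d₀+3e]`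
at `d₀ = 0`, `e = 1`) and `S = ![A, J, B]`: exactly `2m` distinct positive determinant zeros — equality in
`card_posRoots_finset_le_two_mul` for every `m`. [folklore] -/
theorem card_posRoots_diag_census_eq_two_mul :
    ((Matrix.det (∑ k : Fin 3, ((X : ℝ[X]) ^ (![0, 1, 3] k)) •
        (![(Matrix.diagonal fun i : Fin m => (6 * ((3 : ℝ) ^ (i : ℕ)) ^ 3)),
           (Matrix.diagonal fun i : Fin m => (-7 * ((3 : ℝ) ^ (i : ℕ)) ^ 2)),
           (1 : Matrix (Fin m) (Fin m) ℝ)] k).map C)).roots.toFinset.filter (fun t => 0 < t)).card = 2 * m := by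
  rw [← card_posRoots_diag_eq_two_mul m]
  congr 4
  rw [Fin.sum_univ_three]
  simp only [Matrix.cons_val_zero, Matrix.cons_val_one, Matrix.cons_val_two, Matrix.head_cons, Matrix.tail_cons,
    pow_zero, pow_one, one_smul]

end Sharp

end TwoSidedThree

end Summit.ValiantsHypothesis.ValiantsHypothesis.Theorems.KPlusLogSqLaw.TowerGraft
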